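import Mathlib
import HarnessLib
import Literature.Geometry.DiscreteGeometry.BondGraph
import Literature.Geometry.DiscreteGeometry.KissingPatterns
import Summits.AtomisticToContinuum.Crystallization.Theorems.PricedLinkCensusSoftLayerPropagationStubMetricDet

/-!
# Small-cluster rigidity VI: signed volumes through a chart (linear maps and isometries of `ℝ³`)
# (crux `SoftLayerPropagation`, line `Sketch`, stub `stub_metric`, registered sub-goal `metric_det_chart`)

Route `PricedLinkCensus`, crux `SoftLayerPropagation` (stmt-AtomisticToContinuum-14233), line `Sketch`.
The bookkeeping that carries `metric_handedness` (file `…StubMetricDet`) from REAL bond triples to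
chart LABELS: a chart is `p ↦ y j + nn_j • A p` for a linear isometry `A`, the labels of a contact
tetrahedron are an exact unit contact triple `p₁ p₂ p₃`, and `A pᵢ` is again one; `metric_handedness`
compares the real triple with `A pᵢ`, and this file compares `A pᵢ` with `pᵢ`:

* `det3_linearMap` — for ANY linear `L : ℝ³ → ℝ³`,
  `det (L u) (L v) (L w) = c_L · det u v w` with `c_L = det (L e₀) (L e₁) (L e₂)` (the `eᵢ` the standard
  basis vectors `EuclideanSpace.single i 1`): a `ring` identity after expanding `u = Σ uᵢ eᵢ`;
* `det3_frame_sq_eq_one` — for a linear ISOMETRY `A`, `c_A² = 1` (Gram determinant of an orthonormal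
  frame), so `c_A = 1 ∨ c_A = −1` (`det3_frame_eq_one_or`);
* **`metric_det_chart`** (registered) — hence `det (A u) (A v) (A w) = det u v w` for every triple when
  `c_A = 1`, and `= − det u v w` when `c_A = −1`: the handedness of labels read through a chart is that
  of the rotated labels, up to the fixed sign `c_A` of the chart (gauge: composing `A` with the
  pattern's reflection symmetry flips `c_A`: `det3_frame_comp`, `c_{A ∘ R} = c_A c_R`);
* `metric_handedness_chart` — `metric_handedness` with the labels read through a gauge-fixed chart.

All `[folklore]`.
-/

noncomputable section

namespace Summit.AtomisticToContinuum.Crystallization.Theorems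

open Literature.Geometry.DiscreteGeometry

/-- Expansion of a vector of `ℝ³` in the standard basis `eᵢ = EuclideanSpace.single i 1`. [folklore] -/
theorem eq_sum_single_fin3 (u : EuclideanSpace ℝ (Fin 3)) :
    u = u 0 • EuclideanSpace.single 0 1 + u 1 • EuclideanSpace.single 1 1 + u 2 • EuclideanSpace.single 2 1 := by
  ext i; fin_cases i <;> simp

/-- **Signed volumes through a linear map.**  For any linear `L : ℝ³ → ℝ³` and `u v w`,
`det (L u) (L v) (L w) = det (L e₀) (L e₁) (L e₂) · det u v w`. [folklore] -/
theorem det3_linearMap (L : EuclideanSpace ℝ (Fin 3) →ₗ[ℝ] EuclideanSpace ℝ (Fin 3))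
    (u v w : EuclideanSpace ℝ (Fin 3)) :
    Matrix.det ![WithLp.ofLp (L u), WithLp.ofLp (L v), WithLp.ofLp (L w)] =
      Matrix.det ![WithLp.ofLp (L (EuclideanSpace.single 0 1)), WithLp.ofLp (L (EuclideanSpace.single 1 1)),
          WithLp.ofLp (L (EuclideanSpace.single 2 1))] *
        Matrix.det ![WithLp.ofLp u, WithLp.ofLp v, WithLp.ofLp w] := by
  have hu : L u = u 0 • L (EuclideanSpace.single 0 1) + u 1 • L (EuclideanSpace.single 1 1) +
      u 2 • L (EuclideanSpace.single 2 1) := by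
    conv_lhs => rw [eq_sum_single_fin3 u]
    simp only [map_add, map_smul]
  have hv : L v = v 0 • L (EuclideanSpace.single 0 1) + v 1 • L (EuclideanSpace.single 1 1) +
      v 2 • L (EuclideanSpace.single 2 1) := by
    conv_lhs => rw [eq_sum_single_fin3 v]
    simp only [map_add, map_smul]
  have hw : L w = w 0 • L (EuclideanSpace.single 0 1) + w 1 • L (EuclideanSpace.single 1 1) +
      w 2 • L (EuclideanSpace.single 2 1) := by
    conv_lhs => rw [eq_sum_single_fin3 w]
    simp only [map_add, map_smul]
  rw [hu, hv, hw]
  simp only [det3_eq, PiLp.add_apply, PiLp.smul_apply, smul_eq_mul]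
  ring

/-- **The frame volume of a linear isometry is `±1`**: `det (A e₀) (A e₁) (A e₂)² = 1`. [folklore] -/
theorem det3_frame_sq_eq_one (A : EuclideanSpace ℝ (Fin 3) →ₗᵢ[ℝ] EuclideanSpace ℝ (Fin 3)) :
    Matrix.det ![WithLp.ofLp (A (EuclideanSpace.single 0 1)), WithLp.ofLp (A (EuclideanSpace.single 1 1)),
        WithLp.ofLp (A (EuclideanSpace.single 2 1))] ^ 2 = 1 := by
  rw [det3_sq_eq_gram]
  simp only [LinearIsometry.norm_map, LinearIsometry.inner_map_map,
    Literature.Algebra.EuclideanLattices.inner_fin_three, Literature.Algebra.EuclideanLattices.norm_sq_fin_three]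
  simp

/-- Hence `det (A e₀) (A e₁) (A e₂) = 1 ∨ = −1`. [folklore] -/
theorem det3_frame_eq_one_or (A : EuclideanSpace ℝ (Fin 3) →ₗᵢ[ℝ] EuclideanSpace ℝ (Fin 3)) :
    Matrix.det ![WithLp.ofLp (A (EuclideanSpace.single 0 1)), WithLp.ofLp (A (EuclideanSpace.single 1 1)),
        WithLp.ofLp (A (EuclideanSpace.single 2 1))] = 1 ∨
    Matrix.det ![WithLp.ofLp (A (EuclideanSpace.single 0 1)), WithLp.ofLp (A (EuclideanSpace.single 1 1)),
        WithLp.ofLp (A (EuclideanSpace.single 2 1))] = -1 := by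
  have h := det3_frame_sq_eq_one A
  have : (Matrix.det ![WithLp.ofLp (A (EuclideanSpace.single 0 1)), WithLp.ofLp (A (EuclideanSpace.single 1 1)),
        WithLp.ofLp (A (EuclideanSpace.single 2 1))] - 1) *
      (Matrix.det ![WithLp.ofLp (A (EuclideanSpace.single 0 1)), WithLp.ofLp (A (EuclideanSpace.single 1 1)),
        WithLp.ofLp (A (EuclideanSpace.single 2 1))] + 1) = 0 := by
    linear_combination h
  rcases mul_eq_zero.1 this with h1 | h1
  · left; linarith
  · right; linarith

/-- **Registered sub-goal `metric_det_chart`: signed volumes of labels read through a chart.**  For a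
linear isometry `A` of `ℝ³` and any triple `u v w`: if the frame volume `det (A e₀) (A e₁) (A e₂)` is `1`
then `det (A u) (A v) (A w) = det u v w`, and if it is `−1` then `det (A u) (A v) (A w) = − det u v w`;
and the frame volume is one of the two.  (With `metric_handedness`: the labels `pᵢ` of a real contact
tetrahedron have `det (A p₁) (A p₂) (A p₃)` of the sign of the real signed volume, hence `det p₁ p₂ p₃`
of that sign times the chart's handedness `c_A`; two gauge-fixed charts (`c = 1`) at the ends of a bond
therefore read opposite label volumes, `det3_neg_base` — hypothesis `HO` of the development.) [folklore] -/
theorem metric_det_chart : ∀ (A : EuclideanSpace ℝ (Fin 3) →ₗᵢ[ℝ] EuclideanSpace ℝ (Fin 3)),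
    (Matrix.det ![WithLp.ofLp (A (EuclideanSpace.single 0 1)), WithLp.ofLp (A (EuclideanSpace.single 1 1)),
        WithLp.ofLp (A (EuclideanSpace.single 2 1))] = 1 ∨
      Matrix.det ![WithLp.ofLp (A (EuclideanSpace.single 0 1)), WithLp.ofLp (A (EuclideanSpace.single 1 1)),
        WithLp.ofLp (A (EuclideanSpace.single 2 1))] = -1) ∧
    ∀ (u v w : EuclideanSpace ℝ (Fin 3)),
      Matrix.det ![WithLp.ofLp (A u), WithLp.ofLp (A v), WithLp.ofLp (A w)] =
        Matrix.det ![WithLp.ofLp (A (EuclideanSpace.single 0 1)), WithLp.ofLp (A (EuclideanSpace.single 1 1)),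
            WithLp.ofLp (A (EuclideanSpace.single 2 1))] *
          Matrix.det ![WithLp.ofLp u, WithLp.ofLp v, WithLp.ofLp w] := by
  intro A
  exact ⟨det3_frame_eq_one_or A, fun u v w => det3_linearMap A.toLinearMap u v w⟩

/-- The frame volume is multiplicative under composition: `c_{A ∘ B} = c_A · c_B` (so composing a chart
with a pattern symmetry of frame volume `−1` flips its handedness — the gauge fixing). [folklore] -/
theorem det3_frame_comp (A B : EuclideanSpace ℝ (Fin 3) →ₗ[ℝ] EuclideanSpace ℝ (Fin 3)) :
    Matrix.det ![WithLp.ofLp ((A.comp B) (EuclideanSpace.single 0 1)),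
        WithLp.ofLp ((A.comp B) (EuclideanSpace.single 1 1)), WithLp.ofLp ((A.comp B) (EuclideanSpace.single 2 1))] =
      Matrix.det ![WithLp.ofLp (A (EuclideanSpace.single 0 1)), WithLp.ofLp (A (EuclideanSpace.single 1 1)),
          WithLp.ofLp (A (EuclideanSpace.single 2 1))] *
        Matrix.det ![WithLp.ofLp (B (EuclideanSpace.single 0 1)), WithLp.ofLp (B (EuclideanSpace.single 1 1)),
          WithLp.ofLp (B (EuclideanSpace.single 2 1))] := by
  simp only [LinearMap.comp_apply]
  exact det3_linearMap A _ _ _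

/-- **Handedness of labels, chart form.**  Let `A` be a linear isometry with frame volume `1`
(gauge-fixed chart), `p₁ p₂ p₃` an exact unit contact triple of labels, and `w₁ w₂ w₃` a real triple with
norms and mutual distances in `[1 − δ, 1 + δ]` (`δ ≤ 1/20`) which is `1/4`-close to the rotated labels
`A pᵢ`.  Then `det p₁ p₂ p₃ · det w₁ w₂ w₃ > 0`. [folklore] -/
theorem metric_handedness_chart {δ : ℝ} (hδ : 0 ≤ δ) (hδ' : δ ≤ 1 / 20)
    (A : EuclideanSpace ℝ (Fin 3) →ₗᵢ[ℝ] EuclideanSpace ℝ (Fin 3))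
    (hA : Matrix.det ![WithLp.ofLp (A (EuclideanSpace.single 0 1)), WithLp.ofLp (A (EuclideanSpace.single 1 1)),
        WithLp.ofLp (A (EuclideanSpace.single 2 1))] = 1)
    (p₁ p₂ p₃ w₁ w₂ w₃ : EuclideanSpace ℝ (Fin 3))
    (hp₁ : ‖p₁‖ = 1) (hp₂ : ‖p₂‖ = 1) (hp₃ : ‖p₃‖ = 1)
    (hp₁₂ : ‖p₁ - p₂‖ = 1) (hp₁₃ : ‖p₁ - p₃‖ = 1) (hp₂₃ : ‖p₂ - p₃‖ = 1)
    (n₁ : 1 - δ ≤ ‖w₁‖) (n₁' : ‖w₁‖ ≤ 1 + δ) (n₂ : 1 - δ ≤ ‖w₂‖) (n₂' : ‖w₂‖ ≤ 1 + δ)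
    (n₃ : 1 - δ ≤ ‖w₃‖) (n₃' : ‖w₃‖ ≤ 1 + δ)
    (d₁₂ : 1 - δ ≤ ‖w₁ - w₂‖) (d₁₂' : ‖w₁ - w₂‖ ≤ 1 + δ) (d₁₃ : 1 - δ ≤ ‖w₁ - w₃‖) (d₁₃' : ‖w₁ - w₃‖ ≤ 1 + δ)
    (d₂₃ : 1 - δ ≤ ‖w₂ - w₃‖) (d₂₃' : ‖w₂ - w₃‖ ≤ 1 + δ)
    (c₁ : ‖w₁ - A p₁‖ ≤ 1 / 4) (c₂ : ‖w₂ - A p₂‖ ≤ 1 / 4) (c₃ : ‖w₃ - A p₃‖ ≤ 1 / 4) :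
    0 < Matrix.det ![WithLp.ofLp p₁, WithLp.ofLp p₂, WithLp.ofLp p₃] *
      Matrix.det ![WithLp.ofLp w₁, WithLp.ofLp w₂, WithLp.ofLp w₃] := by
  have h := metric_handedness δ hδ hδ' (A p₁) (A p₂) (A p₃) w₁ w₂ w₃
    (by rw [LinearIsometry.norm_map, hp₁]) (by rw [LinearIsometry.norm_map, hp₂])
    (by rw [LinearIsometry.norm_map, hp₃])
    (by rw [← map_sub, LinearIsometry.norm_map, hp₁₂]) (by rw [← map_sub, LinearIsometry.norm_map, hp₁₃])
    (by rw [← map_sub, LinearIsometry.norm_map, hp₂₃])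
    n₁ n₁' n₂ n₂' n₃ n₃' d₁₂ d₁₂' d₁₃ d₁₃' d₂₃ d₂₃' c₁ c₂ c₃
  have e := (metric_det_chart A).2 p₁ p₂ p₃
  rw [hA, one_mul] at e
  rwa [e] at h

end Summit.AtomisticToContinuum.Crystallization.Theorems

end
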